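import Summits.AnomalousDissipation.AnomalousDissipation.Theorems.NeutralTaylorWavesNewtonRealisationCore
import Summits.AnomalousDissipation.AnomalousDissipation.Theorems.NeutralTaylorWavesNewtonRealisationStubCalculusFacts

/-!
# Crux `NewtonRealisation` of route NeutralTaylorWaves (stmt-AnomalousDissipation-16315) — PROVED
# (line `Sketch`: force-side persistence on the Fourier lattice)

`newtonRealisation_proof : Theses.NeutralTaylorWaves.NewtonRealisation`, i.e.
`NonresonantTaylorWaves → (steady zeroth-law family)`: from ONE smooth steady divergence-free mean-zero force `f`,
viscosities `ν_n → 0⁺` and, for every order `K`, infinitely many `n` carrying a LOUD, LIGHT, order-`K` quasi-steady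
drifting state `(w, q, c)` with `ν`-weighted sup bounds and the bordered `L²` a-priori bound `C₀ν^{-K₀}`, produce ONE force,
`ν_j → 0⁺` and time-constant classical Navier–Stokes solutions with bounded energy and dissipation `≥ ε₀/2 > 0`.

Proof (the line `Sketch`, = card `force-side-persistence` ≡ `lattice-fredholm-persistence`): the quasi-steady `(w, q, c)` IS an
exact drifted steady state of the nearby force `f₀ := w·∇w − νΔw + ∇q − c∂₃w` (smooth, mean zero: `stub_calculusFacts`), with
`‖f − f₀‖²₂ ≤ C_Kν^K`; the landed fixed-viscosity persistence theorem `Core.quantBorderedPersistence` (bordered Newton on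
`SteadyLattice.W × ℝ`, constants `k, A`) realises `f` by an exact drifted steady state once `C_Kν^K ≤ P(ν)⁻⁴`, which holds
along the nonresonant subsequence for `K := 4k(K₀+1) + 3` and `ν` below five explicit thresholds (`perStep`, power counting
`persistenceConstant_mul_pow_le`); drift absorption (`stub_driftAbsorption`) turns it into a classical steady solution
`u − c'e₃`; energy `≤ 2E + 2 + (C''+1)²`, dissipation `≥ ε₀/2`.  Stubs of the line (all landed, `--supports`):
`stub_borderedFredholm`, `stub_quadraticNewton`, `stub_latticeDictionary`, `stub_aprioriTransfer`, `stub_ellipticDensity`,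
`stub_calculusFacts`, `stub_driftAbsorption`; skeleton `Cruxes/NewtonRealisation/Lines/Sketch.lean`.
-/

set_option linter.dupNamespace false

noncomputable section

open Filter Set MeasureTheory Topology
open Literature.Analysis.FunctionSpaces Literature.Analysis.FunctionSpaces.Torus

namespace Summit.AnomalousDissipation.AnomalousDissipation.Theorems

/-- The flat unit three-torus (local notation). -/
local notation "𝕋³" => UnitAddTorus (Fin 3)
/-- Velocity values (local notation). -/
local notation "E³" => EuclideanSpace ℝ (Fin 3)

namespace NewtonRealisation

/-- Power-counting lemma (the only asymptotics in the composition): with `m = k(K₀+1)`,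
`A(1 + |C₀|ν^{-K₀})^k(1+C)^kν^{-k} · ν^m ≤ A(1+|C₀|)^k(1+C)^k` for `0 < ν ≤ 1`. -/
theorem persistenceConstant_mul_pow_le {A C C₀ ν : ℝ} {k K₀ : ℕ} (hA : 0 ≤ A) (hC : 0 ≤ C)
    (hν : 0 < ν) (hν1 : ν ≤ 1) :
    A * (1 + |C₀| * ν⁻¹ ^ K₀) ^ k * (1 + C) ^ k * ν⁻¹ ^ k * ν ^ (k * (K₀ + 1)) ≤
      A * (1 + |C₀|) ^ k * (1 + C) ^ k := by
  have hν0 : ν ≠ 0 := hν.ne'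
  have hbase : (1 + |C₀| * ν⁻¹ ^ K₀) * ν⁻¹ * ν ^ (K₀ + 1) = ν ^ K₀ + |C₀| := by
    have h1 : ν⁻¹ ^ K₀ * ν ^ K₀ = 1 := by rw [← mul_pow, inv_mul_cancel₀ hν0, one_pow]
    have h2 : ν⁻¹ * ν = 1 := inv_mul_cancel₀ hν0
    calc (1 + |C₀| * ν⁻¹ ^ K₀) * ν⁻¹ * ν ^ (K₀ + 1)
        = (ν ^ K₀ + |C₀| * (ν⁻¹ ^ K₀ * ν ^ K₀)) * (ν⁻¹ * ν) := by rw [pow_succ]; ring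
      _ = ν ^ K₀ + |C₀| := by rw [h1, h2]; ring
  have hpow : ν ^ (k * (K₀ + 1)) = (ν ^ (K₀ + 1)) ^ k := by rw [mul_comm, pow_mul]
  have hle : ν ^ K₀ + |C₀| ≤ 1 + |C₀| := by
    have : ν ^ K₀ ≤ 1 := pow_le_one₀ hν.le hν1
    linarith
  have hnn : 0 ≤ ν ^ K₀ + |C₀| := by positivity
  calc A * (1 + |C₀| * ν⁻¹ ^ K₀) ^ k * (1 + C) ^ k * ν⁻¹ ^ k * ν ^ (k * (K₀ + 1))
      = A * (1 + C) ^ k * ((1 + |C₀| * ν⁻¹ ^ K₀) * ν⁻¹ * ν ^ (K₀ + 1)) ^ k := by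
        rw [hpow, mul_pow, mul_pow]; ring
    _ = A * (1 + C) ^ k * (ν ^ K₀ + |C₀|) ^ k := by rw [hbase]
    _ ≤ A * (1 + C) ^ k * (1 + |C₀|) ^ k := by
        gcongr
    _ = A * (1 + |C₀|) ^ k * (1 + C) ^ k := by ring

set_option maxHeartbeats 1600000 in
/-- **The per-viscosity step of the force-side composition** (one selected `n`; all thresholds as hypotheses):
from C⁺ (with its constants `k, A`), the calculus facts, drift absorption and the crux's data at ONE state — an order
`K = 4k(K₀+1)+3` quasi-steady state `(w, q, c)` at viscosity `ν` below the five thresholds — produce the classical steady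
solution with energy `≤ 2E + 2 + (C''+1)²` and dissipation `≥ ε₀/2`. -/
theorem perStep {k : ℕ} {A : ℝ}
    (hP : ∀ (ν C M : ℝ) (f₀ f u₀ : 𝕋³ → E³) (p₀ : 𝕋³ → ℝ) (c : ℝ),
      0 < ν → ν ≤ 1 → 0 ≤ C → 0 ≤ M →
      IsSmooth f₀ → HasZeroMean f₀ → IsSmooth f → IsDivFree f → HasZeroMean f →
      IsSmooth u₀ → IsSmooth p₀ → IsDivFree u₀ → HasZeroMean u₀ → |c| ≤ C → (∀ x, ‖u₀ x‖ ≤ C) →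
      (∀ (i : Fin 3) x, ‖Torus.partialDeriv i u₀ x‖ ≤ C * ν⁻¹) →
      (∀ x, Torus.convect u₀ u₀ x - ν • Torus.laplacian u₀ x + Torus.gradient p₀ x -
          c • Torus.partialDeriv (2 : Fin 3) u₀ x = f₀ x) →
      (∀ (v : 𝕋³ → E³) (r : 𝕋³ → ℝ) (b : ℝ), IsSmooth v → IsSmooth r → IsDivFree v → HasZeroMean v →
      MeasureTheory.integral MeasureTheory.volume (fun x => ‖v x‖ ^ 2) + b ^ 2 ≤
        M ^ 2 * (MeasureTheory.integral MeasureTheory.volume (fun x =>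
          ‖Torus.convect u₀ v x + Torus.convect v u₀ x - ν • Torus.laplacian v x + Torus.gradient r x -
            c • Torus.partialDeriv (2 : Fin 3) v x - b • Torus.partialDeriv (2 : Fin 3) u₀ x‖ ^ 2) +
          (MeasureTheory.integral MeasureTheory.volume (fun x =>
            inner ℝ (v x) (Torus.partialDeriv (2 : Fin 3) u₀ x))) ^ 2)) →
      MeasureTheory.integral MeasureTheory.volume (fun x => ‖f x - f₀ x‖ ^ 2) ≤
        ((A * (1 + M) ^ k * (1 + C) ^ k * ν⁻¹ ^ k) ^ 4)⁻¹ →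
      ∃ (u : 𝕋³ → E³) (p : 𝕋³ → ℝ) (c' : ℝ), IsSmooth u ∧ IsSmooth p ∧ IsDivFree u ∧ HasZeroMean u ∧
        (∀ x, Torus.convect u u x - ν • Torus.laplacian u x + Torus.gradient p x -
            c' • Torus.partialDeriv (2 : Fin 3) u x = f x) ∧
        MeasureTheory.integral MeasureTheory.volume (fun x => ‖u x - u₀ x‖ ^ 2) +
            gradNormSq (fun x => u x - u₀ x) + (c' - c) ^ 2 ≤
          (A * (1 + M) ^ k * (1 + C) ^ k * ν⁻¹ ^ k) ^ 2 *
            MeasureTheory.integral MeasureTheory.volume (fun x => ‖f x - f₀ x‖ ^ 2))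
    (hF1 : ∀ (ν : ℝ) (w : 𝕋³ → E³) (q : 𝕋³ → ℝ) (c : ℝ), IsSmooth w → IsDivFree w → IsSmooth q →
      IsSmooth (fun x => Torus.convect w w x - ν • Torus.laplacian w x + Torus.gradient q x -
          c • Torus.partialDeriv (2 : Fin 3) w x) ∧
        HasZeroMean (fun x => Torus.convect w w x - ν • Torus.laplacian w x + Torus.gradient q x -
          c • Torus.partialDeriv (2 : Fin 3) w x))
    (hF2 : ∀ (u v : 𝕋³ → E³), IsSmooth u → IsSmooth v →
      Real.sqrt (gradNormSq v) ≤ Real.sqrt (gradNormSq u) + Real.sqrt (gradNormSq (fun x => u x - v x)) ∧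
      MeasureTheory.integral MeasureTheory.volume (fun x => ‖u x‖ ^ 2) ≤
        2 * MeasureTheory.integral MeasureTheory.volume (fun x => ‖v x‖ ^ 2) +
          2 * MeasureTheory.integral MeasureTheory.volume (fun x => ‖u x - v x‖ ^ 2))
    (hD : ∀ (ν : ℝ) (f W : 𝕋³ → E³) (Q : 𝕋³ → ℝ) (c' : ℝ), IsSmooth W → IsSmooth Q → IsDivFree W →
      HasZeroMean W →
      (∀ x, Torus.convect W W x - ν • Torus.laplacian W x + Torus.gradient Q x -
          c' • Torus.partialDeriv (2 : Fin 3) W x = f x) →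
      IsClassicalNSSolutionOn Set.univ ν (fun _ => f)
          (fun _ x => W x - c' • EuclideanSpace.single (2 : Fin 3) (1 : ℝ)) (fun _ => Q) ∧
        gradNormSq (fun x => W x - c' • EuclideanSpace.single (2 : Fin 3) (1 : ℝ)) = gradNormSq W ∧
        MeasureTheory.integral MeasureTheory.volume
            (fun x => ‖W x - c' • EuclideanSpace.single (2 : Fin 3) (1 : ℝ)‖ ^ 2) =
          MeasureTheory.integral MeasureTheory.volume (fun x => ‖W x‖ ^ 2) + c' ^ 2)
    (hA : 0 < A) {C C₀ E ε₀ ν cc : ℝ} {K₀ : ℕ} (hC'' : 0 ≤ max C 0) (hCC'' : C ≤ max C 0)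
    (_hA' : 0 < A * (1 + |C₀|) ^ k * (1 + max C 0) ^ k) (hC1 : 0 < max C 0 + 1) (hε₀ : 0 < ε₀)
    {f w : 𝕋³ → E³} {q : 𝕋³ → ℝ} (hf : IsSmooth f) (hfd : IsDivFree f) (hfm : HasZeroMean f)
    (hν : 0 < ν) (hν1 : ν ≤ 1)
    (hν2 : ν < ((A * (1 + |C₀|) ^ k * (1 + max C 0) ^ k) ^ 4 * (max C 0 + 1))⁻¹)
    (hν3 : ν < ((A * (1 + |C₀|) ^ k * (1 + max C 0) ^ k) ^ 2 * (max C 0 + 1))⁻¹)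
    (hν4 : ν < (ε₀ / (8 * (max C 0 + 1))) ^ 2) (hν5 : ν < ε₀ / 24)
    (hw : IsSmooth w) (hq : IsSmooth q) (hwd : IsDivFree w) (hwm : HasZeroMean w) (hcC : |cc| ≤ C)
    (hwE : MeasureTheory.integral MeasureTheory.volume (fun x => ‖w x‖ ^ 2) ≤ E)
    (hdiss : |ν * gradNormSq w - ε₀| ≤ C * Real.sqrt ν)
    (hres : MeasureTheory.integral MeasureTheory.volume (fun x =>
        ‖Torus.convect w w x - ν • Torus.laplacian w x + Torus.gradient q x -
          cc • Torus.partialDeriv (2 : Fin 3) w x - f x‖ ^ 2) ≤ C * ν ^ (4 * (k * (K₀ + 1)) + 3))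
    (hsup₀ : ∀ x, ‖w x‖ ≤ C) (hsup₁ : ∀ (i : Fin 3) x, ‖Torus.partialDeriv i w x‖ ≤ C * ν⁻¹)
    (hap : ∀ (v : 𝕋³ → E³) (r : 𝕋³ → ℝ) (b : ℝ), IsSmooth v → IsSmooth r → IsDivFree v → HasZeroMean v →
      MeasureTheory.integral MeasureTheory.volume (fun x => ‖v x‖ ^ 2) + b ^ 2 ≤
        (C₀ * ν⁻¹ ^ K₀) ^ 2 * (MeasureTheory.integral MeasureTheory.volume (fun x =>
          ‖Torus.convect w v x + Torus.convect v w x - ν • Torus.laplacian v x + Torus.gradient r x -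
            cc • Torus.partialDeriv (2 : Fin 3) v x - b • Torus.partialDeriv (2 : Fin 3) w x‖ ^ 2) +
          (MeasureTheory.integral MeasureTheory.volume (fun x =>
            inner ℝ (v x) (Torus.partialDeriv (2 : Fin 3) w x))) ^ 2)) :
    ∃ (u : 𝕋³ → E³) (p : 𝕋³ → ℝ),
      IsClassicalNSSolutionOn Set.univ ν (fun _ => f) (fun _ => u) (fun _ => p) ∧
        MeasureTheory.integral MeasureTheory.volume (fun x => ‖u x‖ ^ 2) ≤ 2 * E + 2 + (max C 0 + 1) ^ 2 ∧
        ε₀ / 2 ≤ ν * gradNormSq u := by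
  have hν0 : ν ≠ 0 := hν.ne'
  -- the exact force `f₀` of the quasi-steady state (smooth, mean zero) and the exact equation
  obtain ⟨hf₀s, hf₀m⟩ := hF1 ν w q cc hw hwd hq
  -- the bordered bound with `M = |C₀| ν^{-K₀}`
  have hM : 0 ≤ |C₀| * ν⁻¹ ^ K₀ := by positivity
  have hBB : (∀ (v : 𝕋³ → E³) (r : 𝕋³ → ℝ) (b : ℝ), IsSmooth v → IsSmooth r → IsDivFree v → HasZeroMean v →
      MeasureTheory.integral MeasureTheory.volume (fun x => ‖v x‖ ^ 2) + b ^ 2 ≤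
        (|C₀| * ν⁻¹ ^ K₀) ^ 2 * (MeasureTheory.integral MeasureTheory.volume (fun x =>
          ‖Torus.convect w v x + Torus.convect v w x - ν • Torus.laplacian v x + Torus.gradient r x -
            cc • Torus.partialDeriv (2 : Fin 3) v x - b • Torus.partialDeriv (2 : Fin 3) w x‖ ^ 2) +
          (MeasureTheory.integral MeasureTheory.volume (fun x =>
            inner ℝ (v x) (Torus.partialDeriv (2 : Fin 3) w x))) ^ 2)) := by
    intro v r b hv hr hvd hvm
    have h := hap v r b hv hr hvd hvm
    have hsq : (|C₀| * ν⁻¹ ^ K₀) ^ 2 = (C₀ * ν⁻¹ ^ K₀) ^ 2 := by rw [mul_pow, mul_pow, sq_abs]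
    rw [hsq]
    exact h
  -- the persistence constant `P` and its power-counting bound `P ν^m ≤ A'`
  have hPpos : 0 < A * (1 + |C₀| * ν⁻¹ ^ K₀) ^ k * (1 + max C 0) ^ k * ν⁻¹ ^ k := by positivity
  have hPm : A * (1 + |C₀| * ν⁻¹ ^ K₀) ^ k * (1 + max C 0) ^ k * ν⁻¹ ^ k * ν ^ (k * (K₀ + 1)) ≤
      A * (1 + |C₀|) ^ k * (1 + max C 0) ^ k :=
    persistenceConstant_mul_pow_le hA.le hC'' hν hν1
  have hPm0 : 0 ≤ A * (1 + |C₀| * ν⁻¹ ^ K₀) ^ k * (1 + max C 0) ^ k * ν⁻¹ ^ k * ν ^ (k * (K₀ + 1)) := by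
    positivity
  -- abbreviations (plain `have`-level names via `generalize`-free `set`)
  set P : ℝ := A * (1 + |C₀| * ν⁻¹ ^ K₀) ^ k * (1 + max C 0) ^ k * ν⁻¹ ^ k with hP_def
  set A' : ℝ := A * (1 + |C₀|) ^ k * (1 + max C 0) ^ k with hA'_def
  set m : ℕ := k * (K₀ + 1) with hm_def
  -- sup bounds with `C'' = max C 0`
  have hcC'' : |cc| ≤ max C 0 := le_trans hcC hCC''
  have hsup₀'' : ∀ x, ‖w x‖ ≤ max C 0 := fun x => le_trans (hsup₀ x) hCC''
  have hsup₁'' : ∀ (i : Fin 3) x, ‖Torus.partialDeriv i w x‖ ≤ max C 0 * ν⁻¹ := fun i x =>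
    le_trans (hsup₁ i x) (mul_le_mul_of_nonneg_right hCC'' (inv_nonneg.2 hν.le))
  -- the residual, read as `‖f − f₀‖²`
  have hres' : MeasureTheory.integral MeasureTheory.volume (fun x => ‖f x -
      (Torus.convect w w x - ν • Torus.laplacian w x + Torus.gradient q x -
        cc • Torus.partialDeriv (2 : Fin 3) w x)‖ ^ 2) ≤ C * ν ^ (4 * m + 3) := by
    have hcongr : (fun x => ‖f x - (Torus.convect w w x - ν • Torus.laplacian w x + Torus.gradient q x -
        cc • Torus.partialDeriv (2 : Fin 3) w x)‖ ^ 2) = fun x => ‖Torus.convect w w x -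
          ν • Torus.laplacian w x + Torus.gradient q x - cc • Torus.partialDeriv (2 : Fin 3) w x -
          f x‖ ^ 2 := by
      funext x
      rw [norm_sub_rev]
    rw [hcongr]
    exact hres
  -- power counting: `ν^K = ν³ (ν^m)^4`
  have hK4 : ν ^ (4 * m + 3) = ν ^ 3 * (ν ^ m) ^ 4 := by
    rw [← pow_mul, ← pow_add]; ring_nf
  have hν3' : ν ^ 3 ≤ ν := by
    have : ν ^ 3 ≤ ν ^ 1 := pow_le_pow_of_le_one hν.le hν1 (by norm_num)
    simpa using this
  have hν32 : ν ^ 3 ≤ ν ^ 2 := pow_le_pow_of_le_one hν.le hν1 (by norm_num)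
  have hνm1 : (ν ^ m) ^ 2 ≤ 1 := pow_le_one₀ (by positivity) (pow_le_one₀ hν.le hν1)
  have hPm4 : (P * ν ^ m) ^ 4 ≤ A' ^ 4 := pow_le_pow_left₀ hPm0 hPm 4
  have hPm2 : (P * ν ^ m) ^ 2 ≤ A' ^ 2 := pow_le_pow_left₀ hPm0 hPm 2
  -- (T1) the Kantorovich premise `C ν^K ≤ P⁻⁴`
  have hT1 : MeasureTheory.integral MeasureTheory.volume (fun x => ‖f x -
      (Torus.convect w w x - ν • Torus.laplacian w x + Torus.gradient q x -
        cc • Torus.partialDeriv (2 : Fin 3) w x)‖ ^ 2) ≤ (P ^ 4)⁻¹ := by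
    have hkey : C * ν ^ (4 * m + 3) * P ^ 4 ≤ 1 := by
      have h1 : C * ν ^ (4 * m + 3) * P ^ 4 = C * (ν ^ 3 * (P * ν ^ m) ^ 4) := by rw [hK4]; ring
      rw [h1]
      have h2 : C * (ν ^ 3 * (P * ν ^ m) ^ 4) ≤ max C 0 * (ν ^ 3 * (P * ν ^ m) ^ 4) :=
        mul_le_mul_of_nonneg_right hCC'' (by positivity)
      have h3 : max C 0 * (ν ^ 3 * (P * ν ^ m) ^ 4) ≤ max C 0 * (ν * A' ^ 4) :=
        mul_le_mul_of_nonneg_left (mul_le_mul hν3' hPm4 (by positivity) hν.le) hC''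
      have h4 : max C 0 * (ν * A' ^ 4) ≤ (max C 0 + 1) * (ν * A' ^ 4) :=
        mul_le_mul_of_nonneg_right (by linarith) (by positivity)
      have h5 : (max C 0 + 1) * (ν * A' ^ 4) < 1 := by
        have hpos : 0 < A' ^ 4 * (max C 0 + 1) := by positivity
        calc (max C 0 + 1) * (ν * A' ^ 4) = ν * (A' ^ 4 * (max C 0 + 1)) := by ring
          _ < (A' ^ 4 * (max C 0 + 1))⁻¹ * (A' ^ 4 * (max C 0 + 1)) :=
              mul_lt_mul_of_pos_right hν2 hpos
          _ = 1 := inv_mul_cancel₀ hpos.ne'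
      linarith
    calc MeasureTheory.integral MeasureTheory.volume (fun x => ‖f x -
          (Torus.convect w w x - ν • Torus.laplacian w x + Torus.gradient q x -
            cc • Torus.partialDeriv (2 : Fin 3) w x)‖ ^ 2)
        ≤ C * ν ^ (4 * m + 3) := hres'
      _ = C * ν ^ (4 * m + 3) * P ^ 4 * (P ^ 4)⁻¹ := by field_simp
      _ ≤ 1 * (P ^ 4)⁻¹ := mul_le_mul_of_nonneg_right hkey (by positivity)
      _ = (P ^ 4)⁻¹ := one_mul _
  -- apply C⁺ at the exact drifted steady state `(w, q, cc)` of the force `f₀`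
  obtain ⟨u, p, c', hu, hp, hud, hum, hueq, hclose⟩ :=
    hP ν (max C 0) (|C₀| * ν⁻¹ ^ K₀) (fun x => Torus.convect w w x - ν • Torus.laplacian w x +
        Torus.gradient q x - cc • Torus.partialDeriv (2 : Fin 3) w x) f w q cc hν hν1 hC'' hM hf₀s hf₀m hf hfd
      hfm hw hq hwd hwm hcC'' hsup₀'' hsup₁'' (fun x => rfl) hBB hT1
  -- (T2) closeness `≤ ν`
  have hT2 : MeasureTheory.integral MeasureTheory.volume (fun x => ‖u x - w x‖ ^ 2) +
      gradNormSq (fun x => u x - w x) + (c' - cc) ^ 2 ≤ ν := by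
    refine le_trans hclose ?_
    have h1 : P ^ 2 * MeasureTheory.integral MeasureTheory.volume (fun x => ‖f x -
        (Torus.convect w w x - ν • Torus.laplacian w x + Torus.gradient q x -
          cc • Torus.partialDeriv (2 : Fin 3) w x)‖ ^ 2) ≤ P ^ 2 * (C * ν ^ (4 * m + 3)) :=
      mul_le_mul_of_nonneg_left hres' (by positivity)
    refine le_trans h1 ?_
    have h2 : P ^ 2 * (C * ν ^ (4 * m + 3)) = C * (ν ^ 3 * (ν ^ m) ^ 2 * (P * ν ^ m) ^ 2) := by
      rw [hK4]; ring
    rw [h2]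
    have h3 : C * (ν ^ 3 * (ν ^ m) ^ 2 * (P * ν ^ m) ^ 2) ≤ max C 0 * (ν ^ 3 * (ν ^ m) ^ 2 * (P * ν ^ m) ^ 2) :=
      mul_le_mul_of_nonneg_right hCC'' (by positivity)
    have h4 : max C 0 * (ν ^ 3 * (ν ^ m) ^ 2 * (P * ν ^ m) ^ 2) ≤ max C 0 * (ν ^ 2 * 1 * A' ^ 2) :=
      mul_le_mul_of_nonneg_left (mul_le_mul (mul_le_mul hν32 hνm1 (by positivity) (by positivity)) hPm2
        (by positivity) (by positivity)) hC''
    have h5 : max C 0 * (ν ^ 2 * 1 * A' ^ 2) ≤ ν * (ν * (A' ^ 2 * (max C 0 + 1))) := by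
      have e : max C 0 * (ν ^ 2 * 1 * A' ^ 2) = ν * (ν * (A' ^ 2 * max C 0)) := by ring
      rw [e]
      have e2 : A' ^ 2 * max C 0 ≤ A' ^ 2 * (max C 0 + 1) :=
        mul_le_mul_of_nonneg_left (by linarith) (by positivity)
      exact mul_le_mul_of_nonneg_left (mul_le_mul_of_nonneg_left e2 hν.le) hν.le
    have h6 : ν * (A' ^ 2 * (max C 0 + 1)) < 1 := by
      have hpos : 0 < A' ^ 2 * (max C 0 + 1) := by positivity
      calc ν * (A' ^ 2 * (max C 0 + 1)) < (A' ^ 2 * (max C 0 + 1))⁻¹ * (A' ^ 2 * (max C 0 + 1)) :=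
            mul_lt_mul_of_pos_right hν3 hpos
        _ = 1 := inv_mul_cancel₀ hpos.ne'
    have h7 : ν * (ν * (A' ^ 2 * (max C 0 + 1))) ≤ ν * 1 := mul_le_mul_of_nonneg_left h6.le hν.le
    linarith
  -- drift absorption
  obtain ⟨hsol, hgrad, hen⟩ := hD ν f u p c' hu hp hud hum hueq
  have hI0 : 0 ≤ MeasureTheory.integral MeasureTheory.volume (fun x => ‖u x - w x‖ ^ 2) :=
    MeasureTheory.integral_nonneg fun _ => sq_nonneg _
  have hg0 : 0 ≤ gradNormSq (fun x => u x - w x) := gradNormSq_nonneg _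
  have hsq0 : 0 ≤ (c' - cc) ^ 2 := sq_nonneg _
  refine ⟨fun x => u x - c' • EuclideanSpace.single (2 : Fin 3) (1 : ℝ), p, hsol, ?_, ?_⟩
  · -- energy
    have hE1 : MeasureTheory.integral MeasureTheory.volume (fun x => ‖u x - w x‖ ^ 2) ≤ 1 := by linarith
    have hcc : (c' - cc) ^ 2 ≤ 1 := by linarith
    have hc'1 : |c'| ≤ max C 0 + 1 := by
      have h1 : |c' - cc| ≤ 1 := by
        have h := Real.sqrt_le_sqrt hcc
        rwa [Real.sqrt_sq_eq_abs, Real.sqrt_one] at h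
      have h2 := abs_sub_abs_le_abs_sub c' cc
      linarith
    have hc'2 : c' ^ 2 ≤ (max C 0 + 1) ^ 2 := by
      refine sq_le_sq.2 ?_
      rw [abs_of_nonneg (by positivity : (0 : ℝ) ≤ max C 0 + 1)]
      exact hc'1
    obtain ⟨-, hsplit⟩ := hF2 u w hu hw
    rw [hen]
    linarith
  · -- dissipation: `‖∇w‖ ≤ ‖∇u‖ + ‖∇(u − w)‖`, `‖∇(u−w)‖² ≤ ν`
    rw [hgrad]
    obtain ⟨hMink, -⟩ := hF2 u w hu hw
    have hgu : 0 ≤ gradNormSq u := gradNormSq_nonneg _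
    have hgw : 0 ≤ gradNormSq w := gradNormSq_nonneg _
    have hguw : gradNormSq (fun x => u x - w x) ≤ ν := by linarith
    have ha0 : 0 ≤ Real.sqrt (gradNormSq u) := Real.sqrt_nonneg _
    have hb0 : 0 ≤ Real.sqrt (gradNormSq (fun x => u x - w x)) := Real.sqrt_nonneg _
    have hs0 : 0 ≤ Real.sqrt (gradNormSq w) := Real.sqrt_nonneg _
    have ha2 : Real.sqrt (gradNormSq u) ^ 2 = gradNormSq u := Real.sq_sqrt hgu
    have hs2 : Real.sqrt (gradNormSq w) ^ 2 = gradNormSq w := Real.sq_sqrt hgw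
    have hb2 : Real.sqrt (gradNormSq (fun x => u x - w x)) ^ 2 ≤ ν := by
      rw [Real.sq_sqrt hg0]; exact hguw
    -- `s² ≤ (a+b)² ≤ (3/2)a² + 3b²`
    have hsq1 : Real.sqrt (gradNormSq w) ^ 2 ≤
        (Real.sqrt (gradNormSq u) + Real.sqrt (gradNormSq (fun x => u x - w x))) ^ 2 :=
      pow_le_pow_left₀ hs0 hMink 2
    have hsq2 : (Real.sqrt (gradNormSq u) + Real.sqrt (gradNormSq (fun x => u x - w x))) ^ 2 ≤
        (3 / 2) * Real.sqrt (gradNormSq u) ^ 2 + 3 * Real.sqrt (gradNormSq (fun x => u x - w x)) ^ 2 := by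
      nlinarith [sq_nonneg (Real.sqrt (gradNormSq u) - 2 * Real.sqrt (gradNormSq (fun x => u x - w x)))]
    have hmain : gradNormSq w ≤ (3 / 2) * gradNormSq u + 3 * ν := by
      rw [← hs2, ← ha2]; linarith
    -- thresholds for the dissipation arithmetic
    have hsqν0 : 0 ≤ Real.sqrt ν := Real.sqrt_nonneg _
    have hsmall : Real.sqrt ν < ε₀ / (8 * (max C 0 + 1)) := by
      calc Real.sqrt ν < Real.sqrt ((ε₀ / (8 * (max C 0 + 1))) ^ 2) := Real.sqrt_lt_sqrt hν.le hν4
        _ = ε₀ / (8 * (max C 0 + 1)) := Real.sqrt_sq (by positivity)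
    have h4 : (max C 0 + 1) * Real.sqrt ν < ε₀ / 8 := by
      calc (max C 0 + 1) * Real.sqrt ν < (max C 0 + 1) * (ε₀ / (8 * (max C 0 + 1))) :=
            mul_lt_mul_of_pos_left hsmall hC1
        _ = ε₀ / 8 := by field_simp
    have h5 : C * Real.sqrt ν ≤ (max C 0 + 1) * Real.sqrt ν :=
      mul_le_mul_of_nonneg_right (by linarith) hsqν0
    have hνsq : ν ^ 2 ≤ ν := by nlinarith
    have hd1 := abs_le.1 hdiss
    have hνgw : ε₀ - C * Real.sqrt ν ≤ ν * gradNormSq w := by linarith [hd1.1, hd1.2]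
    have hνmain : ν * gradNormSq w ≤ (3 / 2) * (ν * gradNormSq u) + 3 * ν ^ 2 := by
      have h := mul_le_mul_of_nonneg_left hmain hν.le
      have e : ν * ((3 / 2) * gradNormSq u + 3 * ν) = (3 / 2) * (ν * gradNormSq u) + 3 * ν ^ 2 := by ring
      linarith
    linarith

end NewtonRealisation

open NewtonRealisation in
set_option maxHeartbeats 1600000 in
/-- **Crux `NewtonRealisation` (stmt-AnomalousDissipation-16315): Newton–Kantorovich realisation of the nonresonant
Taylor-wave family — `NonresonantTaylorWaves → (steady zeroth-law family)`.**  The landed transfer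
`Core.quantBorderedPersistence` (C⁺) + `CalculusFacts.stub_calculusFacts` + `DriftAbsorption.stub_driftAbsorption` imply the
route decl `Theses.NeutralTaylorWaves.NewtonRealisation` BY NAME.  Proof: destructure `NonresonantTaylorWaves`; take
`(k, A)` from C⁺, `m := k(K₀+1)`, `K := 4m + 3`, `C := C_K`, `C'' := max C 0`, `A' := A(1+|C₀|)^k(1+C'')^k`; thresholds
`ν < 1`, `ν < (A'^4(C''+1))⁻¹` (Kantorovich premise `C_Kν^K ≤ P⁻⁴`), `ν < (A'^2(C''+1))⁻¹` (closeness `P²C_Kν^K ≤ ν`),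
`ν < (ε₀/(8(C''+1)))²` and `ν < ε₀/24` (dissipation); per selected `n`: the quasi-steady `(w, q, c)` is an EXACT drifted steady
state of `f₀ := w·∇w − νΔw + ∇q − c∂₃w` (by `rfl`), `∫‖f − f₀‖² = residual ≤ C_Kν^K`, C⁺ realises `f`, drift absorption gives the
classical solution `u − c'e₃`; energy `≤ 2E + 2 + (C''+1)²`, dissipation `≥ ε₀/2` (Minkowski + AM–GM: `‖∇w‖² ≤ (3/2)‖∇u‖² + 3ν`). -/
theorem newtonRealisation_proof :
    Summit.AnomalousDissipation.AnomalousDissipation.Theses.NeutralTaylorWaves.NewtonRealisation := by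
  have hP := NewtonRealisation.Core.quantBorderedPersistence
  have hF := NewtonRealisation.CalculusFacts.stub_calculusFacts
  have hD := NewtonRealisation.DriftAbsorption.stub_driftAbsorption
  unfold Summit.AnomalousDissipation.AnomalousDissipation.Theses.NeutralTaylorWaves.NewtonRealisation
  intro hX
  unfold Summit.AnomalousDissipation.AnomalousDissipation.Theses.NeutralTaylorWaves.NonresonantTaylorWaves at hX
  obtain ⟨f, hf, hfd, hfm, ν, E, ε₀, C₀, K₀, hνpos, hνlim, hε₀, hX⟩ := hX
  obtain ⟨k, A, hA, hP⟩ := hP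
  obtain ⟨hF1, hF2⟩ := hF
  -- the order `K` and the constants
  obtain ⟨C, hX⟩ := hX (4 * (k * (K₀ + 1)) + 3)
  have hC'' : 0 ≤ max C 0 := le_max_right _ _
  have hCC'' : C ≤ max C 0 := le_max_left _ _
  have hA' : 0 < A * (1 + |C₀|) ^ k * (1 + max C 0) ^ k := by positivity
  have hC1 : 0 < max C 0 + 1 := by linarith
  -- the viscosity threshold
  obtain ⟨δ, hδpos, hδ1, hδ2, hδ3, hδ4, hδ5⟩ : ∃ δ : ℝ, 0 < δ ∧ δ ≤ 1 ∧
      δ ≤ ((A * (1 + |C₀|) ^ k * (1 + max C 0) ^ k) ^ 4 * (max C 0 + 1))⁻¹ ∧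
      δ ≤ ((A * (1 + |C₀|) ^ k * (1 + max C 0) ^ k) ^ 2 * (max C 0 + 1))⁻¹ ∧
      δ ≤ (ε₀ / (8 * (max C 0 + 1))) ^ 2 ∧ δ ≤ ε₀ / 24 := by
    refine ⟨min (min (min 1 ((A * (1 + |C₀|) ^ k * (1 + max C 0) ^ k) ^ 4 * (max C 0 + 1))⁻¹)
      (min ((A * (1 + |C₀|) ^ k * (1 + max C 0) ^ k) ^ 2 * (max C 0 + 1))⁻¹ ((ε₀ / (8 * (max C 0 + 1))) ^ 2)))
      (ε₀ / 24), ?_, ?_, ?_, ?_, ?_, ?_⟩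
    · exact lt_min (lt_min (lt_min one_pos (by positivity)) (lt_min (by positivity) (by positivity))) (by positivity)
    · exact le_trans (min_le_left _ _) (le_trans (min_le_left _ _) (min_le_left _ _))
    · exact le_trans (min_le_left _ _) (le_trans (min_le_left _ _) (min_le_right _ _))
    · exact le_trans (min_le_left _ _) (le_trans (min_le_right _ _) (min_le_left _ _))
    · exact le_trans (min_le_left _ _) (le_trans (min_le_right _ _) (min_le_right _ _))
    · exact min_le_right _ _
  obtain ⟨N₁, hN₁⟩ : ∃ N₁ : ℕ, ∀ n', N₁ ≤ n' → ν n' < δ :=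
    Filter.eventually_atTop.1 ((tendsto_order.1 hνlim).2 δ hδpos)
  -- the nonresonant subsequence beyond the threshold, with its certified quasi-steady states
  choose n hn w q c hw hq hwd hwm hcC hwE hdiss hres hsup₀ hsup₁ hsup₂ hap using
    fun j : ℕ => hX (max N₁ j)
  have hjn : ∀ j, j ≤ n j := fun j => le_trans (le_max_right _ _) (hn j)
  have hnδ : ∀ j, ν (n j) < δ := fun j => hN₁ _ (le_trans (le_max_left _ _) (hn j))
  -- realisation at each `j`
  have hreal : ∀ j : ℕ, ∃ (u : 𝕋³ → E³) (p : 𝕋³ → ℝ),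
      IsClassicalNSSolutionOn Set.univ (ν (n j)) (fun _ => f) (fun _ => u) (fun _ => p) ∧
        MeasureTheory.integral MeasureTheory.volume (fun x => ‖u x‖ ^ 2) ≤ 2 * E + 2 + (max C 0 + 1) ^ 2 ∧
        ε₀ / 2 ≤ ν (n j) * gradNormSq u :=
    fun j => perStep hP hF1 hF2 hD hA hC'' hCC'' hA' hC1 hε₀ hf hfd hfm (hνpos (n j))
      (le_trans (hnδ j).le hδ1) (lt_of_lt_of_le (hnδ j) hδ2) (lt_of_lt_of_le (hnδ j) hδ3)
      (lt_of_lt_of_le (hnδ j) hδ4) (lt_of_lt_of_le (hnδ j) hδ5) (hw j) (hq j) (hwd j) (hwm j) (hcC j) (hwE j)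
      (hdiss j) (hres j) (hsup₀ j) (hsup₁ j) (hap j)
  choose u p hsol hEn hDis using hreal
  refine ⟨f, hf, hfd, hfm, fun j => ν (n j), u, p, fun j => hνpos (n j), ?_, hsol,
    ⟨2 * E + 2 + (max C 0 + 1) ^ 2, hEn⟩, ε₀ / 2, half_pos hε₀, hDis⟩
  exact hνlim.comp (tendsto_atTop_mono hjn tendsto_id)

end Summit.AnomalousDissipation.AnomalousDissipation.Theorems

end
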